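import Literature.AlgebraicGeometry.Motives.ProjectiveSpaceHyperplaneMultiplicity
import Literature.AlgebraicGeometry.Motives.ChowProjectiveSpaceInt
import Literature.AlgebraicGeometry.Motives.ChowDegree
import HarnessLib

/-!
# `c₁(𝒪(1))ⁿ ∩ [Lⁿ] = [pt]` and `deg Lⁿ = 1` on `ℙᴺ` (Fulton, Example 2.5.1, §2.5)

Fulton, *Intersection Theory* (2nd ed. 1998), §2.5 defines the degree of a `k`-dimensional
subvariety `V ⊆ ℙⁿ` as `deg V = ∫ c₁(𝒪(1))ᵏ ∩ [V]`, and Example 2.5.1 computes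
`c₁(𝒪(1)) ∩ [Lᵏ] = [Lᵏ⁻¹]` for linear subspaces, whence `c₁(𝒪(1))ᵏ ∩ [Lᵏ] = [L⁰] = [pt]` and
`deg Lᵏ = 1`. With the tree's `c₁(𝒪(1)) ∩ -` (`ProjSpace.hyperplaneSection`,
`Motives/ProjectiveSpaceHyperplaneSection`), its value on linear subspaces
(`ProjSpace.exists_hyperplaneSection_mk_primeCycle_eq`, `Motives/ProjectiveSpaceHyperplaneMultiplicity`)
and the degree `deg : CH₀ → ℤ` (`ChowGroup.degree`, `Motives/ChowDegree`):

* `ProjSpace.hyperplaneSectionToZero N n : CH_n(ℙᴺ_K) →+ CH₀(ℙᴺ_K)` — the iterate `c₁(𝒪(1))ⁿ ∩ -`;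
* `ProjSpace.exists_hyperplaneSectionToZero_ofPoint_eq` — **`c₁(𝒪(1))ⁿ ∩ [Lⁿ] = [L⁰]`**, the class
  of a `K`-point (`K` infinite);
* `ProjSpace.degree_hyperplaneSectionToZero_ofPoint` — **`deg Lⁿ = ∫ c₁(𝒪(1))ⁿ ∩ [Lⁿ] = 1`**
  (`K` algebraically closed, where closed points have degree one, `ChowGroup.degree_ofPoint_eq_one`);
* `ProjSpace.degreeEquiv N r : CH_r(ℙᴺ_K) ≃+ ℤ` (`r ≤ N`, `K` algebraically closed) — **the degree
  `α ↦ ∫ c₁(𝒪(1))ʳ ∩ α` is an isomorphism** (it is `1` on the generator `[Λ_r]` of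
  `CH_r(ℙᴺ) = ℤ · [Λ_r]`, `ProjectiveSpaceCells.ChowGroup.exists_eq_zsmul_coordGenericPoint`,
  `Motives/ChowProjectiveSpaceLines`), taking the class of every `r`-plane to `1`
  (`degreeEquiv_ofPoint`); hence **any two `r`-planes of `ℙᴺ` are rationally equivalent**
  (`IsLinearSubspacePoint.ofPoint_eq_ofPoint_of_id`; Fulton, Example 1.9.3 / §2.5).

Everything is proved; the only definitions are the iterated hyperplane section and the packaged
isomorphism `degreeEquiv`.

## References

* W. Fulton, *Intersection Theory*, 2nd ed., Springer (1998): §2.5 and Example 2.5.1 (p. 41).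
  [Fulton1998]
-/

noncomputable section

universe u

open CategoryTheory AlgebraicGeometry Order

namespace Literature.AlgebraicGeometry.Motives

namespace ProjSpace

variable {K : Type u} [Field K] [Infinite K] (N : ℕ)

/-- **The iterated hyperplane section `c₁(𝒪(1))ⁿ ∩ - : CH_n(ℙᴺ_K) → CH₀(ℙᴺ_K)`** (Fulton, §2.5:
`α ↦ c₁(𝒪(1))ⁿ ∩ α`, whose degree is `deg α`). [cite: Fulton1998, §2.5 (p. 41)] -/
def hyperplaneSectionToZero :
    (n : ℕ) → (ChowGroup (projectiveSpace N K).left n →+ ChowGroup (projectiveSpace N K).left 0)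
  | 0 => AddMonoidHom.id _
  | n + 1 => (hyperplaneSectionToZero n).comp (hyperplaneSection N K n)

/-- `c₁(𝒪(1))⁰ ∩ α = α` (`rfl`). [folklore] -/
@[simp]
theorem hyperplaneSectionToZero_zero (x : ChowGroup (projectiveSpace N K).left 0) :
    hyperplaneSectionToZero N 0 x = x :=
  rfl

/-- `c₁(𝒪(1))ⁿ⁺¹ ∩ α = c₁(𝒪(1))ⁿ ∩ (c₁(𝒪(1)) ∩ α)` (`rfl`). [folklore] -/
theorem hyperplaneSectionToZero_succ (n : ℕ) (x : ChowGroup (projectiveSpace N K).left (n + 1)) :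
    hyperplaneSectionToZero N (n + 1) x = hyperplaneSectionToZero N n (hyperplaneSection N K n x) :=
  rfl

variable {N}

/-- **`c₁(𝒪(1))ⁿ ∩ [Lⁿ] = [L⁰]`**: the `n`-fold hyperplane section of the class of an `n`-plane of
`ℙᴺ_K` is the class of a `0`-plane, i.e. of a `K`-rational point (Fulton, Example 2.5.1 iterated;
`K` infinite). [cite: Fulton1998, Example 2.5.1 (p. 41)] -/
theorem exists_hyperplaneSectionToZero_ofPoint_eq {n : ℕ} {w : ↥(projectiveSpace N K).left}
    (hw : IsLinearSubspacePoint n N (𝟙 (projectiveSpace N K)) w) :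
    ∃ (w₀ : ↥(projectiveSpace N K).left) (hw₀ : IsLinearSubspacePoint 0 N (𝟙 (projectiveSpace N K)) w₀),
      hyperplaneSectionToZero N n (ChowGroup.ofPoint w hw.1) =
        ChowGroup.ofPoint w₀ (hw₀.1.trans Nat.cast_zero) := by
  induction n generalizing w with
  | zero => exact ⟨w, hw, rfl⟩
  | succ n ih =>
    obtain ⟨w', hw', h⟩ := exists_hyperplaneSection_mk_primeCycle_eq hw
    obtain ⟨w₀, hw₀, h0⟩ := ih hw'
    refine ⟨w₀, hw₀, ?_⟩
    rw [hyperplaneSectionToZero_succ, ChowGroup.ofPoint, h, ← h0]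
    rfl

/-- **`deg Lⁿ = ∫_{ℙᴺ} c₁(𝒪(1))ⁿ ∩ [Lⁿ] = 1`** for an `n`-plane of `ℙᴺ_K`, `K` algebraically closed
(Fulton, §2.5 / Example 2.5.1: linear subspaces have degree one). [cite: Fulton1998, Example 2.5.1 (p. 41)] -/
theorem degree_hyperplaneSectionToZero_ofPoint [IsAlgClosed K] {n : ℕ} {w : ↥(projectiveSpace N K).left}
    (hw : IsLinearSubspacePoint n N (𝟙 (projectiveSpace N K)) w) :
    ChowGroup.degree (projectiveSpace N K) (hyperplaneSectionToZero N n (ChowGroup.ofPoint w hw.1)) = 1 := by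
  obtain ⟨w₀, hw₀, h⟩ := exists_hyperplaneSectionToZero_ofPoint_eq hw
  rw [h]
  exact ChowGroup.degree_ofPoint_eq_one _


/-! ### The degree `CH_r(ℙᴺ) ≅ ℤ`; all `r`-planes are rationally equivalent -/

section Degree

omit [Infinite K] in
/-- An `r`-plane point of `ℙᴺ` has `r ≤ N`. [folklore] -/
theorem _root_.Literature.AlgebraicGeometry.Motives.IsLinearSubspacePoint.r_le_of_id {r : ℕ}
    {w : ↥(projectiveSpace N K).left} (hw : IsLinearSubspacePoint r N (𝟙 (projectiveSpace N K)) w) :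
    r ≤ N := by
  obtain ⟨-, -, -, -, -, h⟩ := hw.exists_eq_span_of_id
  exact h

variable [IsAlgClosed K]

/-- The degree `α ↦ ∫ c₁(𝒪(1))ʳ ∩ α` on `CH_r(ℙᴺ_K)` is bijective for `r ≤ N` (`K` algebraically
closed): `CH_r(ℙᴺ) = ℤ · [Λ_r]` and `[Λ_r] ↦ 1`. [cite: Fulton1998, Example 1.9.3 (p. 23) and Example 2.5.1 (p. 41)] -/
theorem degree_comp_hyperplaneSectionToZero_bijective {r : ℕ} (hr : r ≤ N) :
    Function.Bijective ((ChowGroup.degree (projectiveSpace N K)).comp (hyperplaneSectionToZero N r)) := by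
  set φ := (ChowGroup.degree (projectiveSpace N K)).comp (hyperplaneSectionToZero N r) with hφ
  have hg := ProjectiveSpaceCells.isLinearSubspacePoint_coordGenericPoint K hr
  have hφg : φ (ChowGroup.ofPoint (X := (projectiveSpace N K).left)
      (ProjectiveSpaceCells.coordGenericPoint K (n := N) r)
        (ProjectiveSpaceCells.height_coordGenericPoint K hr)) = 1 :=
    degree_hyperplaneSectionToZero_ofPoint hg
  have hφa : ∀ a : ℤ, φ (a • ChowGroup.ofPoint (X := (projectiveSpace N K).left)
      (ProjectiveSpaceCells.coordGenericPoint K (n := N) r)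
        (ProjectiveSpaceCells.height_coordGenericPoint K hr)) = a := fun a => by
    rw [map_zsmul, hφg]
    simp
  constructor
  · rw [injective_iff_map_eq_zero]
    intro x hx
    obtain ⟨a, ha⟩ := ProjectiveSpaceCells.ChowGroup.exists_eq_zsmul_coordGenericPoint K hr x
    have h1 : φ x = a := by
      rw [ha]
      exact hφa a
    rw [hx] at h1
    rw [ha, ← h1]
    exact zero_smul ℤ _
  · exact fun a => ⟨_, hφa a⟩

variable (N) in
/-- **`deg : CH_r(ℙᴺ_K) ≃+ ℤ`, `α ↦ ∫ c₁(𝒪(1))ʳ ∩ α`** (`r ≤ N`, `K` algebraically closed; Fulton,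
Example 1.9.3 with §2.5). [cite: Fulton1998, Example 1.9.3 (p. 23) and §2.5 (p. 41)] -/
def degreeEquiv {r : ℕ} (hr : r ≤ N) : ChowGroup (projectiveSpace N K).left r ≃+ ℤ :=
  AddEquiv.ofBijective _ (degree_comp_hyperplaneSectionToZero_bijective hr)

/-- `degreeEquiv α = deg (c₁(𝒪(1))ʳ ∩ α)` (`rfl`). [folklore] -/
theorem degreeEquiv_apply {r : ℕ} (hr : r ≤ N) (x : ChowGroup (projectiveSpace N K).left r) :
    degreeEquiv N hr x = ChowGroup.degree (projectiveSpace N K) (hyperplaneSectionToZero N r x) :=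
  rfl

/-- **Every `r`-plane of `ℙᴺ` has degree `1`.** [cite: Fulton1998, Example 2.5.1 (p. 41)] -/
theorem degreeEquiv_ofPoint {r : ℕ} {w : ↥(projectiveSpace N K).left}
    (hw : IsLinearSubspacePoint r N (𝟙 (projectiveSpace N K)) w) :
    degreeEquiv N hw.r_le_of_id (ChowGroup.ofPoint w hw.1) = 1 :=
  degree_hyperplaneSectionToZero_ofPoint hw

/-- **Any two `r`-planes of `ℙᴺ_K` are rationally equivalent**: `[closure {w}] = [closure {w'}]` in
`CH_r(ℙᴺ_K)` for `r`-plane points `w, w'` (`K` algebraically closed; both classes have degree `1`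
under the isomorphism `degreeEquiv`). [cite: Fulton1998, Example 1.9.3 (p. 23)] -/
theorem _root_.Literature.AlgebraicGeometry.Motives.IsLinearSubspacePoint.ofPoint_eq_ofPoint_of_id
    {r : ℕ} {w w' : ↥(projectiveSpace N K).left}
    (hw : IsLinearSubspacePoint r N (𝟙 (projectiveSpace N K)) w)
    (hw' : IsLinearSubspacePoint r N (𝟙 (projectiveSpace N K)) w') :
    ChowGroup.ofPoint w hw.1 = ChowGroup.ofPoint w' hw'.1 :=
  (degreeEquiv N hw.r_le_of_id).injective ((degreeEquiv_ofPoint hw).trans (degreeEquiv_ofPoint hw').symm)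

end Degree

end ProjSpace

end Literature.AlgebraicGeometry.Motives

end
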